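import Summits.QuantumFields.BalabanUV.Beta.FP.ExpLocalisedBubbleMixed
import Summits.QuantumFields.BalabanUV.Beta.FP.DecimationSecondMoment

/-!
# `BalabanUV.Beta.FP.ExpLocalisedBubbleMixedShapes` — road «FP», N7 H-route, row H2-ASM-1, part C: THE `hK` AND `hdK` SHAPES OF THE DOUBLE SMEAR —
# `|B z| ≤ (KR+KL)/(‖z‖∞+1)^{a+b+2}` and `|B(z+e_l) − B z| ≤ Kd/(‖z‖∞+1)^{a+b+3}` (third differences of the legs exactly suffice; [folklore] lattice power counting)

HONEST DEPENDENCY (page 1, mandatory): continuum YM on T⁴ ⇐ BetaPertH ∧ nine spine estimates (0/9 proved); BetaPertH ⇐ (D1) ∧ (D4) ∧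
CAP+tail; G-an2-4 gates asym, D1 and NE2/3/4.  HONEST FRAMING (cell contract, verbatim): «discharging `BetaPertH` makes Bałaban's UV
stability UNCONDITIONAL — a real constructive-QFT result; it is NOT the continuum limit and NOT the Clay problem.»  THIS MODULE is elementary [folklore] real
analysis on `ℤ⁴` over `FP/ExpLocalisedBubbleMixed.abs_bubble_sub_lead_le` (this lineage, g8); every analytic input is a HYPOTHESIS; no `def` (the constants `KL`, `Kd` are
WRITTEN OUT in the statements), no `Prop` fact, nothing cited, 0 sorry.  NOT the perfect bubble, NOT `hgerm`, NOT D1, NOT BetaPertH,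
NOT continuum, NOT Clay.

ROW: `H2V-DESIGN.md` f78878bd5f8d2d18 §3∕§4 H2-ASM-1 «+ the first-difference-in-`z` twin (for `hdK`)», RISK (R10) «(K3) exponent 5 is exactly enough» — confirmed here:
the `hdK` shape at order `a+b+3` uses the legs' letters up to THIRD differences only (no fourth differences anywhere).

CONTENT (`B`, `Lead`, `m_j^ℓ_κ`, `KR` as in `FP/ExpLocalisedBubbleMixed`; `n := ‖z‖∞`).
* §1 `abs_moment_fst_le`∕`abs_moment_snd_le` (`|m_j^ℓ_κ| ≤ C_j·Θ δ 1`), `abs_sum_sum_mul_mul_le`, `lead_sub_lead`, `abs_mul_sub_mul_le`, `inv_pow_shift_le` (over `DecimationSecondMoment.supNorm_le_supNorm_add_single`).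
* §2 **`abs_lead_le`**: `|Lead z| ≤ KL/(n+1)^{a+b+2}`, `KL := 16·(C₀Θ₁)(C₁Θ₁)·(B₀A₂ + 2A₁B₁ + A₀B₂)`.
* §3 **`abs_bubble_le`** (the `hK` shape): `|B z| ≤ (KR + KL)/(n+1)^{a+b+2}`.
* §4 **`abs_lead_fwdDiff_le`**, **`abs_bubble_fwdDiff_le`** (the `hdK` shape): `|B(z+e_l) − B z| ≤ Kd/(n+1)^{a+b+3}`,
  `Kd := (2^{a+b+3} + 1)·KR + 16·(C₀Θ₁)(C₁Θ₁)·[(2^{a+2}B₁A₂ + B₀A₃) + 2(2^{b+1}A₂B₁ + A₁B₂) + (2^{b+2}A₁B₂ + A₀B₃)]`.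
Unit `b2b-balaban-beta-d1-formalise-leaf-02` (gen 8).
-/

noncomputable section

namespace Summit.QuantumFields.BalabanUV.Beta.FP.ExpLocalisedBubbleMixedShapes

open Finset Filter Topology fwdDiff
open scoped BigOperators
open Literature.MathematicalPhysics.QuantumFieldTheory.Balaban1983to89
open Literature.MathematicalPhysics.QuantumFieldTheory.Balaban1983to89.Beta
open B12Sec2to5 (l1 l1_nonneg abs_coord_le_l1)
open ExpKernelCalculus (Site Zl Zl_pos)
open Summit.QuantumFields.BalabanUV.Beta.FP.ExpLocalisedBubble
open Summit.QuantumFields.BalabanUV.Beta.FP.ExpLocalisedBubblePoint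
open Summit.QuantumFields.BalabanUV.Beta.FP.ExpLocalisedBubbleOrder2
open Summit.QuantumFields.BalabanUV.Beta.FP.ExpLocalisedBubbleOrder2Point
open Summit.QuantumFields.BalabanUV.Beta.FP.ExpLocalisedBubbleMarginals
open Summit.QuantumFields.BalabanUV.Beta.FP.ExpLocalisedBubbleMixedPieces
open Summit.QuantumFields.BalabanUV.Beta.FP.ExpLocalisedBubbleMixed
open DyadicShell (Pt supNorm supNorm_eq_zero_iff)

/-! ## §1 Bookkeeping -/

section Moments

variable {c : Pt × Pt → ℝ} {C δ : ℝ}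

/-- [folklore] THE FIRST MOMENTS ARE BOUNDED: `|Σ' c p·(p.1)_κ| ≤ C·Θ δ 1`. -/
theorem abs_moment_fst_le (hδ : 0 < δ) (hc : ∀ p : Pt × Pt, |c p| ≤ C * (Real.exp (-δ * l1 p.1) * Real.exp (-δ * l1 p.2))) (κ : Fin 4) :
    |∑' p : Pt × Pt, c p * (p.1 κ : ℝ)| ≤ C * Θ δ 1 := by
  have hs := summable_mul_fst hδ hc κ
  have h := norm_tsum_le_tsum_norm hs.norm
  simp only [Real.norm_eq_abs] at h
  have h1 := tsum_loc_mul_pow_le hδ hc 1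
  refine h.trans ((Summable.tsum_le_tsum (fun p => ?_) hs.abs (summable_loc_mul_pow hδ hc 1)).trans h1)
  rw [abs_mul, pow_one]
  refine mul_le_mul_of_nonneg_left ((abs_coord_le_l1 p.1 κ).trans ?_) (abs_nonneg _)
  linarith [l1_nonneg p.1, l1_nonneg p.2]

/-- [folklore] THE FIRST MOMENTS ARE BOUNDED: `|Σ' c p·(p.2)_κ| ≤ C·Θ δ 1`. -/
theorem abs_moment_snd_le (hδ : 0 < δ) (hc : ∀ p : Pt × Pt, |c p| ≤ C * (Real.exp (-δ * l1 p.1) * Real.exp (-δ * l1 p.2))) (κ : Fin 4) :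
    |∑' p : Pt × Pt, c p * (p.2 κ : ℝ)| ≤ C * Θ δ 1 := by
  have hs := summable_mul_snd hδ hc κ
  have h := norm_tsum_le_tsum_norm hs.norm
  simp only [Real.norm_eq_abs] at h
  have h1 := tsum_loc_mul_pow_le hδ hc 1
  refine h.trans ((Summable.tsum_le_tsum (fun p => ?_) hs.abs (summable_loc_mul_pow hδ hc 1)).trans h1)
  rw [abs_mul, pow_one]
  refine mul_le_mul_of_nonneg_left ((abs_coord_le_l1 p.2 κ).trans ?_) (abs_nonneg _)
  linarith [l1_nonneg p.1, l1_nonneg p.2]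

end Moments

/-- [folklore] `|Σ_iΣ_j m₀_i m₁_j T_ij| ≤ 16·(M₀M₁D)` for `|m₀| ≤ M₀`, `|m₁| ≤ M₁`, `|T| ≤ D`. -/
theorem abs_sum_sum_mul_mul_le {m₀ m₁ : Fin 4 → ℝ} {T : Fin 4 → Fin 4 → ℝ} {M₀ M₁ D : ℝ}
    (hm₀ : ∀ i, |m₀ i| ≤ M₀) (hm₁ : ∀ j, |m₁ j| ≤ M₁) (hT : ∀ i j, |T i j| ≤ D) :
    |∑ i, ∑ j, m₀ i * m₁ j * T i j| ≤ 16 * (M₀ * M₁ * D) := by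
  have hM₀ : 0 ≤ M₀ := (abs_nonneg _).trans (hm₀ 0)
  have hM₁ : 0 ≤ M₁ := (abs_nonneg _).trans (hm₁ 0)
  refine (Finset.abs_sum_le_sum_abs _ _).trans ?_
  have hi : ∀ i ∈ (Finset.univ : Finset (Fin 4)), |∑ j, m₀ i * m₁ j * T i j| ≤ 4 * (M₀ * M₁ * D) := by
    intro i _
    refine (Finset.abs_sum_le_sum_abs _ _).trans ?_
    have hj : ∀ j ∈ (Finset.univ : Finset (Fin 4)), |m₀ i * m₁ j * T i j| ≤ M₀ * M₁ * D := by
      intro j _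
      rw [abs_mul, abs_mul]
      exact mul_le_mul (mul_le_mul (hm₀ i) (hm₁ j) (abs_nonneg _) hM₀) (hT i j) (abs_nonneg _) (by positivity)
    calc _ ≤ ∑ _j : Fin 4, M₀ * M₁ * D := Finset.sum_le_sum hj
      _ = 4 * (M₀ * M₁ * D) := by rw [Finset.sum_const, Finset.card_univ, Fintype.card_fin, nsmul_eq_mul]; norm_num
  calc _ ≤ ∑ _i : Fin 4, 4 * (M₀ * M₁ * D) := Finset.sum_le_sum hi
    _ = 16 * (M₀ * M₁ * D) := by rw [Finset.sum_const, Finset.card_univ, Fintype.card_fin, nsmul_eq_mul]; ring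

/-- [folklore] The difference of two leading terms, regrouped placement by placement. -/
theorem lead_sub_lead (m01 m02 m11 m12 : Fin 4 → ℝ) (t1 t2 t3 t4 t1' t2' t3' t4' : Fin 4 → Fin 4 → ℝ) :
    (-∑ i, ∑ j, (m01 i * m11 j * t1' i j + m01 i * m12 j * t2' i j + m02 i * m11 j * t3' i j + m02 i * m12 j * t4' i j))
      - (-∑ i, ∑ j, (m01 i * m11 j * t1 i j + m01 i * m12 j * t2 i j + m02 i * m11 j * t3 i j + m02 i * m12 j * t4 i j))
      = -(∑ i, ∑ j, m01 i * m11 j * (t1' i j - t1 i j) + ∑ i, ∑ j, m01 i * m12 j * (t2' i j - t2 i j)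
          + ∑ i, ∑ j, m02 i * m11 j * (t3' i j - t3 i j) + ∑ i, ∑ j, m02 i * m12 j * (t4' i j - t4 i j)) := by
  have e : ∀ (g h : Fin 4 → Fin 4 → ℝ), ∑ i, ∑ j, g i j - ∑ i, ∑ j, h i j = ∑ i, ∑ j, (g i j - h i j) := fun g h => by
    rw [← Finset.sum_sub_distrib]; exact Finset.sum_congr rfl fun i _ => by rw [← Finset.sum_sub_distrib]
  rw [neg_sub_neg, e, ← Finset.sum_add_distrib, ← Finset.sum_add_distrib, ← Finset.sum_add_distrib, ← Finset.sum_neg_distrib]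
  refine Finset.sum_congr rfl fun i _ => ?_
  rw [← Finset.sum_add_distrib, ← Finset.sum_add_distrib, ← Finset.sum_add_distrib, ← Finset.sum_neg_distrib]
  exact Finset.sum_congr rfl fun j _ => by ring

/-- [folklore] `|x′y′ − xy| ≤ |x′−x|·|y′| + |x|·|y′−y|` with bounds inserted. -/
theorem abs_mul_sub_mul_le {x x' y y' bx dx by' dy : ℝ} (h1 : |x' - x| ≤ dx) (h2 : |y'| ≤ by') (h3 : |x| ≤ bx) (h4 : |y' - y| ≤ dy) :
    |x' * y' - x * y| ≤ dx * by' + bx * dy := by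
  have e : x' * y' - x * y = (x' - x) * y' + x * (y' - y) := by ring
  rw [e]
  refine (abs_add_le _ _).trans (add_le_add ?_ ?_)
  · rw [abs_mul]; exact mul_le_mul h1 h2 (abs_nonneg _) ((abs_nonneg _).trans h1)
  · rw [abs_mul]; exact mul_le_mul h3 h4 (abs_nonneg _) ((abs_nonneg _).trans h3)

/-- [folklore] A unit step moves the sup norm by at most one (`DecimationSecondMoment.supNorm_le_supNorm_add_single`, reused), hence `(‖z‖∞+1) ≤ 2·(‖z+e_l‖∞+1)` and
inverse powers at the shifted point cost a factor `2^k`. -/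
theorem inv_pow_shift_le (z : Pt) (l : Fin 4) (k : ℕ) {A : ℝ} (hA : 0 ≤ A) :
    A / ((supNorm (z + Pi.single l 1) : ℝ) + 1) ^ k ≤ 2 ^ k * A / ((supNorm z : ℝ) + 1) ^ k := by
  have h := DecimationSecondMoment.supNorm_le_supNorm_add_single z l
  have h' : (supNorm z : ℝ) + 1 ≤ 2 * ((supNorm (z + Pi.single l 1) : ℝ) + 1) := by
    have : (supNorm z : ℝ) ≤ (supNorm (z + Pi.single l 1) : ℝ) + 1 := by exact_mod_cast h
    linarith
  rw [div_le_div_iff₀ (by positivity) (by positivity)]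
  calc A * ((supNorm z : ℝ) + 1) ^ k ≤ A * (2 * ((supNorm (z + Pi.single l 1) : ℝ) + 1)) ^ k :=
        mul_le_mul_of_nonneg_left (pow_le_pow_left₀ (by positivity) h' k) hA
    _ = 2 ^ k * A * ((supNorm (z + Pi.single l 1) : ℝ) + 1) ^ k := by rw [mul_pow]; ring

/-! ## §2 The leading term is `O((‖z‖∞+1)^{−(a+b+2)})` -/

section Main

variable {c₀ c₁ : Pt × Pt → ℝ} {F G : Pt → ℝ} {C₀ C₁ δ A₀ A₁ A₂ A₃ B₀ B₁ B₂ B₃ : ℝ} {a b : ℕ}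

/-- **THE LEADING TERM IS OF ORDER `(‖z‖∞+1)^{−(a+b+2)}`**: `|Lead z| ≤ KL/(‖z‖∞+1)^{a+b+2}`. [folklore] -/
theorem abs_lead_le (hδ : 0 < δ)
    (hc₀ : ∀ p : Pt × Pt, |c₀ p| ≤ C₀ * (Real.exp (-δ * l1 p.1) * Real.exp (-δ * l1 p.2)))
    (hc₁ : ∀ p : Pt × Pt, |c₁ p| ≤ C₁ * (Real.exp (-δ * l1 p.1) * Real.exp (-δ * l1 p.2)))
    (hF : ∀ t : Pt, |F t| ≤ A₀ / ((supNorm t : ℝ) + 1) ^ a ∧ (∀ i, |Δ_[(Pi.single i 1 : Pt)] F t| ≤ A₁ / ((supNorm t : ℝ) + 1) ^ (a + 1))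
      ∧ (∀ i j, |Δ_[(Pi.single i 1 : Pt)] (Δ_[(Pi.single j 1 : Pt)] F) t| ≤ A₂ / ((supNorm t : ℝ) + 1) ^ (a + 2))
      ∧ (∀ i j l, |Δ_[(Pi.single i 1 : Pt)] (Δ_[(Pi.single j 1 : Pt)] (Δ_[(Pi.single l 1 : Pt)] F)) t| ≤ A₃ / ((supNorm t : ℝ) + 1) ^ (a + 3)))
    (hG : ∀ t : Pt, |G t| ≤ B₀ / ((supNorm t : ℝ) + 1) ^ b ∧ (∀ i, |Δ_[(Pi.single i 1 : Pt)] G t| ≤ B₁ / ((supNorm t : ℝ) + 1) ^ (b + 1))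
      ∧ (∀ i j, |Δ_[(Pi.single i 1 : Pt)] (Δ_[(Pi.single j 1 : Pt)] G) t| ≤ B₂ / ((supNorm t : ℝ) + 1) ^ (b + 2))
      ∧ (∀ i j l, |Δ_[(Pi.single i 1 : Pt)] (Δ_[(Pi.single j 1 : Pt)] (Δ_[(Pi.single l 1 : Pt)] G)) t| ≤ B₃ / ((supNorm t : ℝ) + 1) ^ (b + 3)))
    (z : Pt) :
    |(-∑ i, ∑ j, ((∑' p : Pt × Pt, c₀ p * (p.1 i : ℝ)) * (∑' p : Pt × Pt, c₁ p * (p.1 j : ℝ))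
              * (G z * Δ_[(Pi.single i 1 : Pt)] (Δ_[(Pi.single j 1 : Pt)] F) z)
            + (∑' p : Pt × Pt, c₀ p * (p.1 i : ℝ)) * (∑' p : Pt × Pt, c₁ p * (p.2 j : ℝ))
              * (Δ_[(Pi.single i 1 : Pt)] F z * Δ_[(Pi.single j 1 : Pt)] G z)
            + (∑' p : Pt × Pt, c₀ p * (p.2 i : ℝ)) * (∑' p : Pt × Pt, c₁ p * (p.1 j : ℝ))
              * (Δ_[(Pi.single j 1 : Pt)] F z * Δ_[(Pi.single i 1 : Pt)] G z)
            + (∑' p : Pt × Pt, c₀ p * (p.2 i : ℝ)) * (∑' p : Pt × Pt, c₁ p * (p.2 j : ℝ))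
              * (F z * Δ_[(Pi.single i 1 : Pt)] (Δ_[(Pi.single j 1 : Pt)] G) z)))|
      ≤ 16 * ((C₀ * Θ δ 1) * (C₁ * Θ δ 1) * (B₀ * A₂ + A₁ * B₁ + A₁ * B₁ + A₀ * B₂)) / ((supNorm z : ℝ) + 1) ^ (a + b + 2) := by
  set N : ℝ := (supNorm z : ℝ) + 1 with hN
  have hN1 : 1 ≤ N := by rw [hN]; have := (Nat.cast_nonneg (supNorm z) : (0:ℝ) ≤ _); linarith
  have m01 := abs_moment_fst_le hδ hc₀
  have m02 := abs_moment_snd_le hδ hc₀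
  have m11 := abs_moment_fst_le hδ hc₁
  have m12 := abs_moment_snd_le hδ hc₁
  have hp1 : N ^ (a + b + 2) = N ^ b * N ^ (a + 2) := by rw [← pow_add]; congr 1; ring
  have hp2 : N ^ (a + b + 2) = N ^ (a + 1) * N ^ (b + 1) := by rw [← pow_add]; congr 1; ring
  have hp4 : N ^ (a + b + 2) = N ^ a * N ^ (b + 2) := by rw [← pow_add]; congr 1
  have t1 : ∀ i j, |G z * Δ_[(Pi.single i 1 : Pt)] (Δ_[(Pi.single j 1 : Pt)] F) z| ≤ B₀ * A₂ / N ^ (a + b + 2) := fun i j => by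
    rw [abs_mul, hp1, ← div_mul_div_comm]
    exact mul_le_mul (hG z).1 ((hF z).2.2.1 i j) (abs_nonneg _) ((abs_nonneg _).trans (hG z).1)
  have t2 : ∀ i j, |Δ_[(Pi.single i 1 : Pt)] F z * Δ_[(Pi.single j 1 : Pt)] G z| ≤ A₁ * B₁ / N ^ (a + b + 2) := fun i j => by
    rw [abs_mul, hp2, ← div_mul_div_comm]
    exact mul_le_mul ((hF z).2.1 i) ((hG z).2.1 j) (abs_nonneg _) ((abs_nonneg _).trans ((hF z).2.1 i))
  have t3 : ∀ i j, |Δ_[(Pi.single j 1 : Pt)] F z * Δ_[(Pi.single i 1 : Pt)] G z| ≤ A₁ * B₁ / N ^ (a + b + 2) := fun i j => t2 j i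
  have t4 : ∀ i j, |F z * Δ_[(Pi.single i 1 : Pt)] (Δ_[(Pi.single j 1 : Pt)] G) z| ≤ A₀ * B₂ / N ^ (a + b + 2) := fun i j => by
    rw [abs_mul, hp4, ← div_mul_div_comm]
    exact mul_le_mul (hF z).1 ((hG z).2.2.1 i j) (abs_nonneg _) ((abs_nonneg _).trans (hF z).1)
  have s1 := abs_sum_sum_mul_mul_le m01 m11 t1
  have s2 := abs_sum_sum_mul_mul_le m01 m12 t2
  have s3 := abs_sum_sum_mul_mul_le m02 m11 t3
  have s4 := abs_sum_sum_mul_mul_le m02 m12 t4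
  rw [abs_neg]
  have esplit : ∑ i, ∑ j, ((∑' p : Pt × Pt, c₀ p * (p.1 i : ℝ)) * (∑' p : Pt × Pt, c₁ p * (p.1 j : ℝ))
              * (G z * Δ_[(Pi.single i 1 : Pt)] (Δ_[(Pi.single j 1 : Pt)] F) z)
            + (∑' p : Pt × Pt, c₀ p * (p.1 i : ℝ)) * (∑' p : Pt × Pt, c₁ p * (p.2 j : ℝ))
              * (Δ_[(Pi.single i 1 : Pt)] F z * Δ_[(Pi.single j 1 : Pt)] G z)
            + (∑' p : Pt × Pt, c₀ p * (p.2 i : ℝ)) * (∑' p : Pt × Pt, c₁ p * (p.1 j : ℝ))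
              * (Δ_[(Pi.single j 1 : Pt)] F z * Δ_[(Pi.single i 1 : Pt)] G z)
            + (∑' p : Pt × Pt, c₀ p * (p.2 i : ℝ)) * (∑' p : Pt × Pt, c₁ p * (p.2 j : ℝ))
              * (F z * Δ_[(Pi.single i 1 : Pt)] (Δ_[(Pi.single j 1 : Pt)] G) z))
      = ∑ i, ∑ j, (∑' p : Pt × Pt, c₀ p * (p.1 i : ℝ)) * (∑' p : Pt × Pt, c₁ p * (p.1 j : ℝ))
              * (G z * Δ_[(Pi.single i 1 : Pt)] (Δ_[(Pi.single j 1 : Pt)] F) z)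
        + ∑ i, ∑ j, (∑' p : Pt × Pt, c₀ p * (p.1 i : ℝ)) * (∑' p : Pt × Pt, c₁ p * (p.2 j : ℝ))
              * (Δ_[(Pi.single i 1 : Pt)] F z * Δ_[(Pi.single j 1 : Pt)] G z)
        + ∑ i, ∑ j, (∑' p : Pt × Pt, c₀ p * (p.2 i : ℝ)) * (∑' p : Pt × Pt, c₁ p * (p.1 j : ℝ))
              * (Δ_[(Pi.single j 1 : Pt)] F z * Δ_[(Pi.single i 1 : Pt)] G z)
        + ∑ i, ∑ j, (∑' p : Pt × Pt, c₀ p * (p.2 i : ℝ)) * (∑' p : Pt × Pt, c₁ p * (p.2 j : ℝ))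
              * (F z * Δ_[(Pi.single i 1 : Pt)] (Δ_[(Pi.single j 1 : Pt)] G) z) := by
    simp only [Finset.sum_add_distrib]
  rw [esplit]
  refine (abs_add_le _ _).trans ((add_le_add ((abs_add_le _ _).trans (add_le_add ((abs_add_le _ _).trans (add_le_add s1 s2)) s3)) s4).trans
    (le_of_eq ?_))
  field_simp

/-- **THE `hK` SHAPE**: `|B z| ≤ (KR + KL)/(‖z‖∞+1)^{a+b+2}`. [folklore] -/
theorem abs_bubble_le (hδ : 0 < δ)
    (hc₀ : ∀ p : Pt × Pt, |c₀ p| ≤ C₀ * (Real.exp (-δ * l1 p.1) * Real.exp (-δ * l1 p.2)))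
    (hc₁ : ∀ p : Pt × Pt, |c₁ p| ≤ C₁ * (Real.exp (-δ * l1 p.1) * Real.exp (-δ * l1 p.2)))
    (hm₀ : ∑' p : Pt × Pt, c₀ p = 0) (hm₁ : ∑' p : Pt × Pt, c₁ p = 0)
    (hF : ∀ t : Pt, |F t| ≤ A₀ / ((supNorm t : ℝ) + 1) ^ a ∧ (∀ i, |Δ_[(Pi.single i 1 : Pt)] F t| ≤ A₁ / ((supNorm t : ℝ) + 1) ^ (a + 1))
      ∧ (∀ i j, |Δ_[(Pi.single i 1 : Pt)] (Δ_[(Pi.single j 1 : Pt)] F) t| ≤ A₂ / ((supNorm t : ℝ) + 1) ^ (a + 2))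
      ∧ (∀ i j l, |Δ_[(Pi.single i 1 : Pt)] (Δ_[(Pi.single j 1 : Pt)] (Δ_[(Pi.single l 1 : Pt)] F)) t| ≤ A₃ / ((supNorm t : ℝ) + 1) ^ (a + 3)))
    (hG : ∀ t : Pt, |G t| ≤ B₀ / ((supNorm t : ℝ) + 1) ^ b ∧ (∀ i, |Δ_[(Pi.single i 1 : Pt)] G t| ≤ B₁ / ((supNorm t : ℝ) + 1) ^ (b + 1))
      ∧ (∀ i j, |Δ_[(Pi.single i 1 : Pt)] (Δ_[(Pi.single j 1 : Pt)] G) t| ≤ B₂ / ((supNorm t : ℝ) + 1) ^ (b + 2))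
      ∧ (∀ i j l, |Δ_[(Pi.single i 1 : Pt)] (Δ_[(Pi.single j 1 : Pt)] (Δ_[(Pi.single l 1 : Pt)] G)) t| ≤ B₃ / ((supNorm t : ℝ) + 1) ^ (b + 3)))
    (z : Pt) :
    |∑' P : (Pt × Pt) × (Pt × Pt), c₀ P.1 * c₁ P.2 * F (z + P.2.1 - P.1.1) * G (z + P.2.2 - P.1.2)|
      ≤ ((A₀ * ((C₁ * Zl 4 δ) * (C₀ * Zl 4 δ) * K₂ δ B₀ B₁ B₂ B₃ b)
          + 4 * A₁ * ((C₁ * Zm δ 1) * (C₀ * Zl 4 δ) * K₁ δ B₀ B₁ B₂ b + (C₁ * Zl 4 δ) * (C₀ * Zm δ 1) * K₁ δ B₀ B₁ B₂ b)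
          + B₀ * ((C₁ * Zl 4 δ) * (C₀ * Zl 4 δ) * K₂ δ A₀ A₁ A₂ A₃ a)
          + (C₀ * C₁ * K₁ δ A₀ A₁ A₂ a) * K₀ δ B₀ B₁ b)
        + 16 * ((C₀ * Θ δ 1) * (C₁ * Θ δ 1) * (B₀ * A₂ + A₁ * B₁ + A₁ * B₁ + A₀ * B₂))) / ((supNorm z : ℝ) + 1) ^ (a + b + 2) := by
  have h1 := abs_bubble_sub_lead_le hδ hc₀ hc₁ hm₀ hm₁ hF hG z
  have h2 := abs_lead_le hδ hc₀ hc₁ hF hG z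
  set N : ℝ := (supNorm z : ℝ) + 1 with hN
  have hN1 : 1 ≤ N := by rw [hN]; have := (Nat.cast_nonneg (supNorm z) : (0:ℝ) ≤ _); linarith
  set KR : ℝ := (A₀ * ((C₁ * Zl 4 δ) * (C₀ * Zl 4 δ) * K₂ δ B₀ B₁ B₂ B₃ b)
          + 4 * A₁ * ((C₁ * Zm δ 1) * (C₀ * Zl 4 δ) * K₁ δ B₀ B₁ B₂ b + (C₁ * Zl 4 δ) * (C₀ * Zm δ 1) * K₁ δ B₀ B₁ B₂ b)
          + B₀ * ((C₁ * Zl 4 δ) * (C₀ * Zl 4 δ) * K₂ δ A₀ A₁ A₂ A₃ a)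
          + (C₀ * C₁ * K₁ δ A₀ A₁ A₂ a) * K₀ δ B₀ B₁ b) with hKRdef
  have hKR : 0 ≤ KR := by
    have h0 := (abs_nonneg _).trans h1
    have hp : (0 : ℝ) < N ^ (a + b + 3) := by positivity
    by_contra hneg
    have := div_neg_of_neg_of_pos (not_le.mp hneg) hp
    linarith
  have h1' : KR / N ^ (a + b + 3) ≤ KR / N ^ (a + b + 2) := by
    refine div_le_div_of_nonneg_left hKR (by positivity) ?_
    rw [pow_succ]
    exact le_mul_of_one_le_right (by positivity) hN1
  rw [add_div]
  have := abs_sub_abs_le_abs_sub (∑' P : (Pt × Pt) × (Pt × Pt), c₀ P.1 * c₁ P.2 * F (z + P.2.1 - P.1.1) * G (z + P.2.2 - P.1.2)) _ |>.trans h1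
  linarith


/-! ## §4 The first difference (the `hdK` shape) -/

/-- **THE FIRST DIFFERENCE OF THE LEADING TERM**: `|Lead(z+e_l) − Lead z| ≤ KdL/(‖z‖∞+1)^{a+b+3}` — each placement differenced by the product rule, one factor at the
next letter (up to THIRD differences), the shifted factor at `2^k` times its letter at `z`. [folklore] -/
theorem abs_lead_fwdDiff_le (hδ : 0 < δ)
    (hc₀ : ∀ p : Pt × Pt, |c₀ p| ≤ C₀ * (Real.exp (-δ * l1 p.1) * Real.exp (-δ * l1 p.2)))
    (hc₁ : ∀ p : Pt × Pt, |c₁ p| ≤ C₁ * (Real.exp (-δ * l1 p.1) * Real.exp (-δ * l1 p.2)))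
    (hF : ∀ t : Pt, |F t| ≤ A₀ / ((supNorm t : ℝ) + 1) ^ a ∧ (∀ i, |Δ_[(Pi.single i 1 : Pt)] F t| ≤ A₁ / ((supNorm t : ℝ) + 1) ^ (a + 1))
      ∧ (∀ i j, |Δ_[(Pi.single i 1 : Pt)] (Δ_[(Pi.single j 1 : Pt)] F) t| ≤ A₂ / ((supNorm t : ℝ) + 1) ^ (a + 2))
      ∧ (∀ i j l, |Δ_[(Pi.single i 1 : Pt)] (Δ_[(Pi.single j 1 : Pt)] (Δ_[(Pi.single l 1 : Pt)] F)) t| ≤ A₃ / ((supNorm t : ℝ) + 1) ^ (a + 3)))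
    (hG : ∀ t : Pt, |G t| ≤ B₀ / ((supNorm t : ℝ) + 1) ^ b ∧ (∀ i, |Δ_[(Pi.single i 1 : Pt)] G t| ≤ B₁ / ((supNorm t : ℝ) + 1) ^ (b + 1))
      ∧ (∀ i j, |Δ_[(Pi.single i 1 : Pt)] (Δ_[(Pi.single j 1 : Pt)] G) t| ≤ B₂ / ((supNorm t : ℝ) + 1) ^ (b + 2))
      ∧ (∀ i j l, |Δ_[(Pi.single i 1 : Pt)] (Δ_[(Pi.single j 1 : Pt)] (Δ_[(Pi.single l 1 : Pt)] G)) t| ≤ B₃ / ((supNorm t : ℝ) + 1) ^ (b + 3)))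
    (z : Pt) (l : Fin 4) :
    |(-∑ i, ∑ j, ((∑' p : Pt × Pt, c₀ p * (p.1 i : ℝ)) * (∑' p : Pt × Pt, c₁ p * (p.1 j : ℝ))
              * (G (z + Pi.single l 1) * Δ_[(Pi.single i 1 : Pt)] (Δ_[(Pi.single j 1 : Pt)] F) (z + Pi.single l 1))
            + (∑' p : Pt × Pt, c₀ p * (p.1 i : ℝ)) * (∑' p : Pt × Pt, c₁ p * (p.2 j : ℝ))
              * (Δ_[(Pi.single i 1 : Pt)] F (z + Pi.single l 1) * Δ_[(Pi.single j 1 : Pt)] G (z + Pi.single l 1))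
            + (∑' p : Pt × Pt, c₀ p * (p.2 i : ℝ)) * (∑' p : Pt × Pt, c₁ p * (p.1 j : ℝ))
              * (Δ_[(Pi.single j 1 : Pt)] F (z + Pi.single l 1) * Δ_[(Pi.single i 1 : Pt)] G (z + Pi.single l 1))
            + (∑' p : Pt × Pt, c₀ p * (p.2 i : ℝ)) * (∑' p : Pt × Pt, c₁ p * (p.2 j : ℝ))
              * (F (z + Pi.single l 1) * Δ_[(Pi.single i 1 : Pt)] (Δ_[(Pi.single j 1 : Pt)] G) (z + Pi.single l 1))))
        - (-∑ i, ∑ j, ((∑' p : Pt × Pt, c₀ p * (p.1 i : ℝ)) * (∑' p : Pt × Pt, c₁ p * (p.1 j : ℝ))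
              * (G z * Δ_[(Pi.single i 1 : Pt)] (Δ_[(Pi.single j 1 : Pt)] F) z)
            + (∑' p : Pt × Pt, c₀ p * (p.1 i : ℝ)) * (∑' p : Pt × Pt, c₁ p * (p.2 j : ℝ))
              * (Δ_[(Pi.single i 1 : Pt)] F z * Δ_[(Pi.single j 1 : Pt)] G z)
            + (∑' p : Pt × Pt, c₀ p * (p.2 i : ℝ)) * (∑' p : Pt × Pt, c₁ p * (p.1 j : ℝ))
              * (Δ_[(Pi.single j 1 : Pt)] F z * Δ_[(Pi.single i 1 : Pt)] G z)
            + (∑' p : Pt × Pt, c₀ p * (p.2 i : ℝ)) * (∑' p : Pt × Pt, c₁ p * (p.2 j : ℝ))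
              * (F z * Δ_[(Pi.single i 1 : Pt)] (Δ_[(Pi.single j 1 : Pt)] G) z)))|
      ≤ 16 * ((C₀ * Θ δ 1) * (C₁ * Θ δ 1) * ((B₁ * (2 ^ (a + 2) * A₂) + B₀ * A₃) + (A₂ * (2 ^ (b + 1) * B₁) + A₁ * B₂)
          + (A₂ * (2 ^ (b + 1) * B₁) + A₁ * B₂) + (A₁ * (2 ^ (b + 2) * B₂) + A₀ * B₃))) / ((supNorm z : ℝ) + 1) ^ (a + b + 3) := by
  set N : ℝ := (supNorm z : ℝ) + 1 with hN
  have hN1 : 1 ≤ N := by rw [hN]; have := (Nat.cast_nonneg (supNorm z) : (0:ℝ) ≤ _); linarith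
  have hA2 : 0 ≤ A₂ := nonneg_of_decay_pow fun t => (hF t).2.2.1 0 0
  have hB1 : 0 ≤ B₁ := nonneg_of_decay_pow fun t => (hG t).2.1 0
  have hB2 : 0 ≤ B₂ := nonneg_of_decay_pow fun t => (hG t).2.2.1 0 0
  have m01 := abs_moment_fst_le hδ hc₀
  have m02 := abs_moment_snd_le hδ hc₀
  have m11 := abs_moment_fst_le hδ hc₁
  have m12 := abs_moment_snd_le hδ hc₁
  set z' : Pt := z + Pi.single l 1 with hz'
  -- shifted letters
  have sF2 : ∀ i j, |Δ_[(Pi.single i 1 : Pt)] (Δ_[(Pi.single j 1 : Pt)] F) z'| ≤ 2 ^ (a + 2) * A₂ / N ^ (a + 2) :=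
    fun i j => ((hF z').2.2.1 i j).trans (inv_pow_shift_le z l (a + 2) hA2)
  have sG1 : ∀ j, |Δ_[(Pi.single j 1 : Pt)] G z'| ≤ 2 ^ (b + 1) * B₁ / N ^ (b + 1) :=
    fun j => ((hG z').2.1 j).trans (inv_pow_shift_le z l (b + 1) hB1)
  have sG2 : ∀ i j, |Δ_[(Pi.single i 1 : Pt)] (Δ_[(Pi.single j 1 : Pt)] G) z'| ≤ 2 ^ (b + 2) * B₂ / N ^ (b + 2) :=
    fun i j => ((hG z').2.2.1 i j).trans (inv_pow_shift_le z l (b + 2) hB2)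
  -- powers
  have hp1 : N ^ (b + 1) * N ^ (a + 2) = N ^ (a + b + 3) := by rw [← pow_add]; congr 1; ring
  have hp1' : N ^ b * N ^ (a + 3) = N ^ (a + b + 3) := by rw [← pow_add]; congr 1; ring
  have hp2 : N ^ (a + 2) * N ^ (b + 1) = N ^ (a + b + 3) := by rw [← pow_add]; congr 1; ring
  have hp2' : N ^ (a + 1) * N ^ (b + 2) = N ^ (a + b + 3) := by rw [← pow_add]; congr 1; ring
  have hp4 : N ^ (a + 1) * N ^ (b + 2) = N ^ (a + b + 3) := hp2'
  have hp4' : N ^ a * N ^ (b + 3) = N ^ (a + b + 3) := by rw [← pow_add]; congr 1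
  -- the four placements differenced
  have d1 : ∀ i j, |G z' * Δ_[(Pi.single i 1 : Pt)] (Δ_[(Pi.single j 1 : Pt)] F) z' - G z * Δ_[(Pi.single i 1 : Pt)] (Δ_[(Pi.single j 1 : Pt)] F) z|
      ≤ (B₁ * (2 ^ (a + 2) * A₂) + B₀ * A₃) / N ^ (a + b + 3) := fun i j => by
    have h := abs_mul_sub_mul_le ((hG z).2.1 l) (sF2 i j) (hG z).1 ((hF z).2.2.2 l i j)
    refine h.trans (le_of_eq ?_)
    rw [div_mul_div_comm, div_mul_div_comm, hp1, hp1', add_div]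
  have d2 : ∀ i j, |Δ_[(Pi.single i 1 : Pt)] F z' * Δ_[(Pi.single j 1 : Pt)] G z' - Δ_[(Pi.single i 1 : Pt)] F z * Δ_[(Pi.single j 1 : Pt)] G z|
      ≤ (A₂ * (2 ^ (b + 1) * B₁) + A₁ * B₂) / N ^ (a + b + 3) := fun i j => by
    have h := abs_mul_sub_mul_le ((hF z).2.2.1 l i) (sG1 j) ((hF z).2.1 i) ((hG z).2.2.1 l j)
    refine h.trans (le_of_eq ?_)
    rw [div_mul_div_comm, div_mul_div_comm, hp2, hp2', add_div]
  have d3 : ∀ i j, |Δ_[(Pi.single j 1 : Pt)] F z' * Δ_[(Pi.single i 1 : Pt)] G z' - Δ_[(Pi.single j 1 : Pt)] F z * Δ_[(Pi.single i 1 : Pt)] G z|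
      ≤ (A₂ * (2 ^ (b + 1) * B₁) + A₁ * B₂) / N ^ (a + b + 3) := fun i j => d2 j i
  have d4 : ∀ i j, |F z' * Δ_[(Pi.single i 1 : Pt)] (Δ_[(Pi.single j 1 : Pt)] G) z' - F z * Δ_[(Pi.single i 1 : Pt)] (Δ_[(Pi.single j 1 : Pt)] G) z|
      ≤ (A₁ * (2 ^ (b + 2) * B₂) + A₀ * B₃) / N ^ (a + b + 3) := fun i j => by
    have h := abs_mul_sub_mul_le ((hF z).2.1 l) (sG2 i j) (hF z).1 ((hG z).2.2.2 l i j)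
    refine h.trans (le_of_eq ?_)
    rw [div_mul_div_comm, div_mul_div_comm, hp4, hp4', add_div]
  have s1 := abs_sum_sum_mul_mul_le m01 m11 d1
  have s2 := abs_sum_sum_mul_mul_le m01 m12 d2
  have s3 := abs_sum_sum_mul_mul_le m02 m11 d3
  have s4 := abs_sum_sum_mul_mul_le m02 m12 d4
  rw [lead_sub_lead, abs_neg]
  refine (abs_add_le _ _).trans ((add_le_add ((abs_add_le _ _).trans (add_le_add ((abs_add_le _ _).trans (add_le_add s1 s2)) s3)) s4).trans
    (le_of_eq ?_))
  field_simp

/-- **H2-ASM-1, THE `hdK` SHAPE**: `|B(z+e_l) − B z| ≤ Kd/(‖z‖∞+1)^{a+b+3}` — from `abs_bubble_sub_lead_le` at `z` and at `z+e_l` (`(‖z+e_l‖∞+1) ≥ (‖z‖∞+1)/2`) and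
`abs_lead_fwdDiff_le`; the legs' letters enter up to THIRD differences only. [folklore] -/
theorem abs_bubble_fwdDiff_le (hδ : 0 < δ)
    (hc₀ : ∀ p : Pt × Pt, |c₀ p| ≤ C₀ * (Real.exp (-δ * l1 p.1) * Real.exp (-δ * l1 p.2)))
    (hc₁ : ∀ p : Pt × Pt, |c₁ p| ≤ C₁ * (Real.exp (-δ * l1 p.1) * Real.exp (-δ * l1 p.2)))
    (hm₀ : ∑' p : Pt × Pt, c₀ p = 0) (hm₁ : ∑' p : Pt × Pt, c₁ p = 0)
    (hF : ∀ t : Pt, |F t| ≤ A₀ / ((supNorm t : ℝ) + 1) ^ a ∧ (∀ i, |Δ_[(Pi.single i 1 : Pt)] F t| ≤ A₁ / ((supNorm t : ℝ) + 1) ^ (a + 1))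
      ∧ (∀ i j, |Δ_[(Pi.single i 1 : Pt)] (Δ_[(Pi.single j 1 : Pt)] F) t| ≤ A₂ / ((supNorm t : ℝ) + 1) ^ (a + 2))
      ∧ (∀ i j l, |Δ_[(Pi.single i 1 : Pt)] (Δ_[(Pi.single j 1 : Pt)] (Δ_[(Pi.single l 1 : Pt)] F)) t| ≤ A₃ / ((supNorm t : ℝ) + 1) ^ (a + 3)))
    (hG : ∀ t : Pt, |G t| ≤ B₀ / ((supNorm t : ℝ) + 1) ^ b ∧ (∀ i, |Δ_[(Pi.single i 1 : Pt)] G t| ≤ B₁ / ((supNorm t : ℝ) + 1) ^ (b + 1))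
      ∧ (∀ i j, |Δ_[(Pi.single i 1 : Pt)] (Δ_[(Pi.single j 1 : Pt)] G) t| ≤ B₂ / ((supNorm t : ℝ) + 1) ^ (b + 2))
      ∧ (∀ i j l, |Δ_[(Pi.single i 1 : Pt)] (Δ_[(Pi.single j 1 : Pt)] (Δ_[(Pi.single l 1 : Pt)] G)) t| ≤ B₃ / ((supNorm t : ℝ) + 1) ^ (b + 3)))
    (z : Pt) (l : Fin 4) :
    |∑' P : (Pt × Pt) × (Pt × Pt), c₀ P.1 * c₁ P.2 * F (z + Pi.single l 1 + P.2.1 - P.1.1) * G (z + Pi.single l 1 + P.2.2 - P.1.2)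
        - ∑' P : (Pt × Pt) × (Pt × Pt), c₀ P.1 * c₁ P.2 * F (z + P.2.1 - P.1.1) * G (z + P.2.2 - P.1.2)|
      ≤ ((2 ^ (a + b + 3) + 1) * (A₀ * ((C₁ * Zl 4 δ) * (C₀ * Zl 4 δ) * K₂ δ B₀ B₁ B₂ B₃ b)
          + 4 * A₁ * ((C₁ * Zm δ 1) * (C₀ * Zl 4 δ) * K₁ δ B₀ B₁ B₂ b + (C₁ * Zl 4 δ) * (C₀ * Zm δ 1) * K₁ δ B₀ B₁ B₂ b)
          + B₀ * ((C₁ * Zl 4 δ) * (C₀ * Zl 4 δ) * K₂ δ A₀ A₁ A₂ A₃ a)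
          + (C₀ * C₁ * K₁ δ A₀ A₁ A₂ a) * K₀ δ B₀ B₁ b)
        + 16 * ((C₀ * Θ δ 1) * (C₁ * Θ δ 1) * ((B₁ * (2 ^ (a + 2) * A₂) + B₀ * A₃) + (A₂ * (2 ^ (b + 1) * B₁) + A₁ * B₂)
          + (A₂ * (2 ^ (b + 1) * B₁) + A₁ * B₂) + (A₁ * (2 ^ (b + 2) * B₂) + A₀ * B₃)))) / ((supNorm z : ℝ) + 1) ^ (a + b + 3) := by
  have h1 := abs_bubble_sub_lead_le hδ hc₀ hc₁ hm₀ hm₁ hF hG z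
  have h1' := abs_bubble_sub_lead_le hδ hc₀ hc₁ hm₀ hm₁ hF hG (z + Pi.single l 1)
  have h2 := abs_lead_fwdDiff_le hδ hc₀ hc₁ hF hG z l
  set N : ℝ := (supNorm z : ℝ) + 1 with hN
  have hN1 : 1 ≤ N := by rw [hN]; have := (Nat.cast_nonneg (supNorm z) : (0:ℝ) ≤ _); linarith
  set KR : ℝ := (A₀ * ((C₁ * Zl 4 δ) * (C₀ * Zl 4 δ) * K₂ δ B₀ B₁ B₂ B₃ b)
          + 4 * A₁ * ((C₁ * Zm δ 1) * (C₀ * Zl 4 δ) * K₁ δ B₀ B₁ B₂ b + (C₁ * Zl 4 δ) * (C₀ * Zm δ 1) * K₁ δ B₀ B₁ B₂ b)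
          + B₀ * ((C₁ * Zl 4 δ) * (C₀ * Zl 4 δ) * K₂ δ A₀ A₁ A₂ A₃ a)
          + (C₀ * C₁ * K₁ δ A₀ A₁ A₂ a) * K₀ δ B₀ B₁ b) with hKRdef
  have hKR : 0 ≤ KR := by
    have h0 := (abs_nonneg _).trans h1
    have hp : (0 : ℝ) < N ^ (a + b + 3) := by positivity
    by_contra hneg
    have := div_neg_of_neg_of_pos (not_le.mp hneg) hp
    linarith
  have h1'' := h1'.trans (inv_pow_shift_le z l (a + b + 3) hKR)
  rw [abs_sub_comm] at h1
  have key := (abs_sub_le _ _ _).trans (add_le_add ((abs_sub_le _ _ _).trans (add_le_add h1'' h2)) h1)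
  refine key.trans (le_of_eq ?_)
  field_simp
  ring

end Main

end Summit.QuantumFields.BalabanUV.Beta.FP.ExpLocalisedBubbleMixedShapes

end
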